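import Summits.QuantumFields.BalabanUV.Beta.GAN24.AliasWeightsClosedForm
import Summits.QuantumFields.BalabanUV.Beta.GAN24.SymbolProjector

/-!
# `BalabanUV.Beta.GAN24.ReadingWeightRates` — binder row G-an2-4 / (CONV-C), road P1-fibre, typer row **P1-Y11r** (node N17r of
# `GAN24/Formal/LEAVES.md` v2.1; Part B of `SKELETON-P1.md`), part 1 = items (i)–(ii): TERMWISE TWO-SCALE RATES of the reading-weight
# factors and of the scaled `T`-block coefficients at a fixed alias label `q`

NOT IN PRINT; OUR PROOF ATTEMPT.  HONEST FRAMING (cell contract, verbatim): «discharging `BetaPertH` makes Bałaban's UV stability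
UNCONDITIONAL — a real constructive-QFT result; it is NOT the continuum limit and NOT the Clay problem.»  HONEST DEPENDENCY (verbatim):
«continuum YM on T⁴ ⇐ BetaPertH ∧ nine spine estimates (0/9 proved); BetaPertH ⇐ (D1) ∧ (D4) ∧ CAP+tail; G-an2-4 gates asym, D1 and
NE2/3/4.»  [folklore] explicit real analysis (Taylor/Jordan for `sin`, the closed form of the geometric sums of leaf P1-L06, the symbol
rates of leaf P1-L07 BY NAME); discharges NOTHING of (CONV-C) by itself: it supplies the termwise `O(|q|²/N²) = O(Lc^{−2(j+1)})` rates that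
the assembly rows (Y11r (iii)(iv), p1's L11 `FibreRate`) sum into the one-step rate `θ = Lc⁻²` of (I2′).  NOT `BetaPertH`, NOT continuum,
NOT Clay.  One harmless real-valued `def` (`sincAt`, the level-free limit of the reading modulus); no `def … : Prop`, no cited fact, no wall
binder, constants exact (`π/12`, `π/48`, `π²/48`, `1/24`, `1/6`, `π²/32`); NO unit (`sfStep/smStep`) is re-typed (ref2 TRIGGER-P1 c2/c3).

## Setting (SKELETON-P1 S1c / B1–B3; LEAVES.md v2.1 row Y11r)
A level is a pair (box side `N`, block side `M`) — in the application `N = Lc^{j+1}`, `M = Lc^j`, and the next level is `(N·Lc, N)`; the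
ratio `ρ = M/N = Lc⁻¹` is the same at both levels.  At a fixed ALIAS LABEL `q = p + 2π·rep(m)` (one coordinate: a real `q` with
`|q| ≤ πN`, i.e. the symmetric representative) the fine momentum is `x = q/N` and the per-coordinate reading-weight factor is the geometric sum
`G(q/N, M) = Σ_{t<M} e^{i(q/N)t}` of leaf P1-L06 (explicit `Finset.range` currency, as there), normalised by `M`.
* §1 the sinc-ratio Taylor bound `|x/sin x − 1| ≤ (π/12)·x²` on `0 < x ≤ π/2` and its reciprocal form `|1/|sin t| − 1/|t|| ≤ (π/12)|t|`;
* §2 (row item (i), moduli) `‖G(q/N, M)‖/M` is within `(π/48)·q²/N²` of the LEVEL-FREE limit `sincAt (M/N) q = |sin(ρq/2)|/(ρ|q|/2)`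
  (`norm_geomExp_div_sub_sincAt_le`), hence two levels with the same ratio `M/N = M′/N′` differ by `≤ (π/48)·q²·(1/N² + 1/N′²)`
  (`norm_geomExp_div_sub_norm_geomExp_div_le`) — the `O(Lc^{−2(j+1)})` termwise rate of the reading/source weight factors;
* §3 (row item (i), phases) the PHASE/MODULUS factorisation `G(x, M) = e^{i(M−1)x/2} · sin(Mx/2)/sin(x/2)` (`geomExp_eq_phase_mul`) and the
  two LEVEL-INDEPENDENCE identities of B1 («the first-order terms are pure phases that cancel»): the reading phase `k·M = q/Lc` at both
  levels (`fine_mul_block_eq`) and the half-bond phase bookkeeping `(M−1)x_κ/2 − (M−1)x_l/2 + (x_κ − x_l)/2 = M(x_κ − x_l)/2`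
  (`half_bond_phases_combine`: the `e^{−ix/2}`-type phases of `s_κ s♭_l` are exactly compensated by the `e^{i(x_κ−x_l)/2}` of
  `SymbolProjector.dhat_mul_dflat_div_lapSym_ofRealVec`, leaving the level-free `e^{iM(x_κ−x_l)/2}`, `Mx = q/Lc`);
* §4 (row item (ii)) PHASE-STRIPPED rates of the scaled `T`-block coefficients at real `N > 0` from leaf P1-L07 BY NAME and King 1986 §4:
  the lattice symbol `A_N(q) = Σ_κ (2N sin(q_κ/2N))²` vs `|q|²` two-level (`abs_lat_sub_lat_le`), its inverse
  `|A_N⁻¹ − |q|⁻²| ≤ (π²/48)/N²` on the zone (`abs_inv_lat_sub_inv_momSq_le`, = `King1986.latticeSymbol_inv_sub_ref_le` through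
  `SymbolTaylor.sum_sq_mul_four_sin_sq_eq_latticeSymbol`) and two-level, the sine vector `s^N_κ = 2N sin(q_κ/2N)` two-level, the
  transverse projector two-level (`SymbolProjector.abs_proj_sin_sub_proj_le`), and the mixed coefficient `s^N_κ/A_N(q)` (→ `q_κ/|q|²`):
  `|s^N_κ/A_N − q_κ/|q|²| ≤ (π²/32)·|q|/N²` (`abs_sin_div_lat_sub_le`).  (The product rule `|ab − a′b′| ≤ |a − a′||b| + |a′||b − b′|` for
  the assembly part is already in the tree: `Literature.Probability.Moments.abs_mul_sub_mul_le`.)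
Items (iii) (product rule over the alias sum + tail) and (iv) (assembled `T`-block rate) of row Y11r follow in the companion module once the
reading/source weight OBJECTS of row Y09b (`GAN24/ReadingWeightSums`, leaf-01) are in the tree.

Unit `b2b-balaban-gan24-formalise-leaf-17` (G-an2-4 formalisation swarm, leaf prover 17), 2026-08-19.  Value = kernel bookkeeping leaf
toward the K-slot route P1, NOT summit progress.
-/

noncomputable section

open Complex Finset
open scoped BigOperators Real

namespace Summit.QuantumFields.BalabanUV.Beta.GAN24.ReadingWeightRates

open AliasWeights AliasWeightsClosedForm
open Literature.MathematicalPhysics.QuantumFieldTheory.King1986 (momSq momSq_nonneg latticeSymbol latticeSymbol_inv_sub_ref_le)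

variable {D : ℕ}

/-! ## §1  The sinc-ratio Taylor bound -/

/-- [folklore] Reciprocal sinc-ratio bound: `|1/|sin t| − 1/|t|| ≤ (π/12)·|t|` for `0 < |t| ≤ π/2`
(`|t − sin t| ≤ |t|³/6` above, Jordan `|sin t| ≥ (2/π)|t|` below). -/
theorem abs_inv_abs_sin_sub_inv_abs_le {t : ℝ} (ht0 : t ≠ 0) (ht : |t| ≤ π / 2) :
    abs (1 / |Real.sin t| - 1 / |t|) ≤ π / 12 * |t| := by
  have hπ := Real.pi_pos
  have hta : 0 < |t| := abs_pos.2 ht0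
  -- |sin t| = sin |t| on |t| ≤ π, hence Jordan for |sin t|
  have hsin_abs : |Real.sin t| = Real.sin |t| := by
    rcases le_total 0 t with h | h
    · rw [abs_of_nonneg h]
      exact abs_of_nonneg (Real.sin_nonneg_of_nonneg_of_le_pi h (by rw [abs_of_nonneg h] at ht; linarith))
    · have hnt : Real.sin t ≤ 0 := by
        have := Real.sin_nonneg_of_nonneg_of_le_pi (by linarith : 0 ≤ -t) (by rw [abs_of_nonpos h] at ht; linarith)
        rw [Real.sin_neg] at this
        linarith
      rw [abs_of_nonpos h, abs_of_nonpos hnt, Real.sin_neg]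
  have hj : 2 / π * |t| ≤ |Real.sin t| := by
    rw [hsin_abs]
    exact Real.mul_le_sin hta.le ht
  have hs : 0 < |Real.sin t| := lt_of_lt_of_le (by positivity) hj
  have hT : |t - Real.sin t| ≤ |t| ^ 3 / 6 := Real.abs_sub_sin_le t
  have hrev : |(|t| - |Real.sin t|)| ≤ |t - Real.sin t| := abs_abs_sub_abs_le_abs_sub t (Real.sin t)
  rw [div_sub_div _ _ hs.ne' hta.ne', one_mul, mul_one, abs_div, abs_mul, abs_abs, abs_abs,
    div_le_iff₀ (by positivity)]
  calc |(|t| - |Real.sin t|)| ≤ |t - Real.sin t| := hrev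
    _ ≤ |t| ^ 3 / 6 := hT
    _ = π / 12 * |t| * ((2 / π * |t|) * |t|) := by field_simp; ring
    _ ≤ π / 12 * |t| * (|Real.sin t| * |t|) := by gcongr

/-- [folklore] The sinc-ratio Taylor bound of row Y11r (i): `|x/sin x − 1| ≤ (π/12)·x²` for `0 < x ≤ π/2`. -/
theorem abs_div_sin_sub_one_le {x : ℝ} (h0 : 0 < x) (h1 : x ≤ π / 2) : |x / Real.sin x - 1| ≤ π / 12 * x ^ 2 := by
  have hsin : 0 < Real.sin x := Real.sin_pos_of_pos_of_lt_pi h0 (by linarith [Real.pi_pos])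
  have h := abs_inv_abs_sin_sub_inv_abs_le h0.ne' (by rwa [abs_of_pos h0])
  rw [abs_of_pos hsin, abs_of_pos h0] at h
  have e : x / Real.sin x - 1 = x * (1 / Real.sin x - 1 / x) := by field_simp
  rw [e, abs_mul, abs_of_pos h0]
  calc x * |1 / Real.sin x - 1 / x| ≤ x * (π / 12 * x) := mul_le_mul_of_nonneg_left h h0.le
    _ = π / 12 * x ^ 2 := by ring

/-! ## §2  Row item (i), moduli: the reading-weight factor `‖G(q/N, M)‖/M` against its level-free limit -/

/-- The LEVEL-FREE LIMIT of the normalised reading modulus at ratio `ρ = M/N` (`= Lc⁻¹`): `sincAt ρ q = |sin(ρq/2)| / (ρ|q|/2)`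
(`= |sin(q/(2Lc))|/(|q|/(2Lc))`; Lean's `x/0 = 0` makes it `0` at `q = 0` or `ρ = 0`). -/
def sincAt (ρ q : ℝ) : ℝ := 2 * |Real.sin (ρ * q / 2)| / (ρ * |q|)

/-- [folklore] `0 ≤ sincAt ρ q` for `ρ ≥ 0`. -/
theorem sincAt_nonneg {ρ : ℝ} (hρ : 0 ≤ ρ) (q : ℝ) : 0 ≤ sincAt ρ q := by
  unfold sincAt; positivity

/-- [folklore] `sincAt ρ q ≤ 1` (`|sin z| ≤ |z|`). -/
theorem sincAt_le_one (ρ q : ℝ) : sincAt ρ q ≤ 1 := by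
  unfold sincAt
  rcases eq_or_ne (ρ * |q|) 0 with h | h
  · rw [h, div_zero]; exact zero_le_one
  · have hpos : 0 < |ρ * q| := by
      rw [abs_mul]
      have : ρ * |q| ≠ 0 := h
      rcases mul_ne_zero_iff.1 this with ⟨hρ, hq⟩
      exact mul_pos (abs_pos.2 hρ) (lt_of_le_of_ne (abs_nonneg q) (Ne.symm hq))
    have hs : |Real.sin (ρ * q / 2)| ≤ |ρ * q / 2| := Real.abs_sin_le_abs
    rw [abs_div, abs_two] at hs
    have hle : 2 * |Real.sin (ρ * q / 2)| ≤ |ρ * q| := by linarith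
    calc 2 * |Real.sin (ρ * q / 2)| / (ρ * |q|) ≤ 2 * |Real.sin (ρ * q / 2)| / |ρ * q| := by
          rw [abs_mul]
          rcases le_or_gt 0 ρ with hρ | hρ
          · rw [abs_of_nonneg hρ]
          · -- ρ < 0: the left side is ≤ 0
            have : 2 * |Real.sin (ρ * q / 2)| / (ρ * |q|) ≤ 0 :=
              div_nonpos_of_nonneg_of_nonpos (by positivity) (mul_nonpos_of_nonpos_of_nonneg hρ.le (abs_nonneg q))
            exact this.trans (by positivity)
      _ ≤ 1 := (div_le_one hpos).2 hle

/-- [folklore] **READING MODULUS RATE** (row Y11r (i)): at level (box `N`, block `M`), for an alias label `0 < |q| ≤ πN` (symmetric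
representative), `| ‖G(q/N, M)‖/M − sincAt (M/N) q | ≤ (π/48)·q²/N²`.  Proof: with `t = q/(2N)`, the closed form of leaf P1-L06 gives
`‖G‖ = |sin(Mt)|/|sin t|`, the limit is `|sin(Mt)|/(M|t|)`, and `|sin(Mt)|·|1/|sin t| − 1/|t|| ≤ M|t|·(π/12)|t|`. -/
theorem norm_geomExp_div_sub_sincAt_le {M N : ℕ} (hM : 0 < M) (hN : 0 < N) {q : ℝ} (hq0 : q ≠ 0) (hq : |q| ≤ π * N) :
    abs (‖∑ t ∈ Finset.range M, cexp (I * (q / N : ℝ) * t)‖ / M - sincAt ((M : ℝ) / N) q) ≤ π / 48 * q ^ 2 / N ^ 2 := by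
  have hπ := Real.pi_pos
  have hMr : (0 : ℝ) < M := by exact_mod_cast hM
  have hNr : (0 : ℝ) < N := by exact_mod_cast hN
  have hqa : 0 < |q| := abs_pos.2 hq0
  -- the half fine momentum t = q/(2N)
  have ht_abs : |q / N / 2| = |q| / N / 2 := by rw [abs_div, abs_div, abs_of_pos hNr, abs_two]
  have ht0 : q / N / 2 ≠ 0 := by positivity
  have ht : |q / N / 2| ≤ π / 2 := by
    rw [ht_abs, div_div, div_le_iff₀ (by positivity)]
    nlinarith
  have hsin_ne : Real.sin (q / N / 2) ≠ 0 := by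
    intro h0
    have h1 : -π < q / N / 2 := by
      have := (abs_le.1 ht).1; linarith
    have h2 : q / N / 2 < π := by
      have := (abs_le.1 ht).2; linarith
    exact ht0 ((Real.sin_eq_zero_iff_of_lt_of_lt h1 h2).1 h0)
  -- closed form of the geometric sum (leaf P1-L06 part 3)
  have hG := norm_geomExp_eq_div (q / N) M hsin_ne
  -- the numerator S = |sin(M t)| and its bound S ≤ M |t|
  set S := |Real.sin (M * (q / N) / 2)| with hS
  have hSle : S ≤ M * |q / N / 2| := by
    have h := Real.abs_sin_le_abs (x := (M : ℝ) * (q / N) / 2)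
    have e : |(M : ℝ) * (q / N) / 2| = M * |q / N / 2| := by
      rw [show (M : ℝ) * (q / N) / 2 = M * (q / N / 2) by ring, abs_mul, abs_of_pos hMr]
    rw [e] at h
    rw [hS]
    exact h
  -- the limit in the same variables
  have hlim : sincAt ((M : ℝ) / N) q = S / (M * |q / N / 2|) := by
    unfold sincAt
    rw [hS, ht_abs, show (M : ℝ) / N * q / 2 = M * (q / N) / 2 by ring]
    field_simp
  -- the difference
  have hkey := abs_inv_abs_sin_sub_inv_abs_le ht0 ht
  have hsabs : 0 < |Real.sin (q / N / 2)| := abs_pos.2 hsin_ne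
  have hdiff : ‖∑ t ∈ Finset.range M, cexp (I * (q / N : ℝ) * t)‖ / M - sincAt ((M : ℝ) / N) q
      = S / M * (1 / |Real.sin (q / N / 2)| - 1 / |q / N / 2|) := by
    rw [hG, hlim, hS]
    field_simp
  rw [hdiff, abs_mul, abs_div, abs_of_nonneg (abs_nonneg _), abs_of_pos hMr]
  calc S / M * abs (1 / |Real.sin (q / N / 2)| - 1 / |q / N / 2|)
      ≤ (M * |q / N / 2|) / M * (π / 12 * |q / N / 2|) := by
        refine mul_le_mul (div_le_div_of_nonneg_right hSle hMr.le) hkey (abs_nonneg _) (by positivity)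
    _ = π / 48 * q ^ 2 / N ^ 2 := by
        rw [ht_abs]
        field_simp
        rw [sq_abs]
        ring

/-- [folklore] **TWO-LEVEL READING MODULUS RATE** (row Y11r (i)): two levels with the same block/box ratio `M/N = M′/N′` (in the application
`(N, M) = (Lc^{j+1}, Lc^j)` and `(N′, M′) = (Lc^{j+2}, Lc^{j+1})`) have the same limit, hence
`| ‖G(q/N, M)‖/M − ‖G(q/N′, M′)‖/M′ | ≤ (π/48)·q²·(1/N² + 1/N′²)` for `0 < |q| ≤ π·min(N, N′)`. -/
theorem norm_geomExp_div_sub_norm_geomExp_div_le {M N M' N' : ℕ} (hM : 0 < M) (hN : 0 < N) (hM' : 0 < M') (hN' : 0 < N')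
    (hratio : (M : ℝ) * N' = M' * N) {q : ℝ} (hq0 : q ≠ 0) (hq : |q| ≤ π * N) (hq' : |q| ≤ π * N') :
    abs (‖∑ t ∈ Finset.range M, cexp (I * (q / N : ℝ) * t)‖ / M - ‖∑ t ∈ Finset.range M', cexp (I * (q / N' : ℝ) * t)‖ / M')
      ≤ π / 48 * q ^ 2 * (1 / (N : ℝ) ^ 2 + 1 / (N' : ℝ) ^ 2) := by
  have h1 := norm_geomExp_div_sub_sincAt_le hM hN hq0 hq
  have h2 := norm_geomExp_div_sub_sincAt_le hM' hN' hq0 hq'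
  have hNr : (N : ℝ) ≠ 0 := by exact_mod_cast hN.ne'
  have hN'r : (N' : ℝ) ≠ 0 := by exact_mod_cast hN'.ne'
  have hρ : (M : ℝ) / N = (M' : ℝ) / N' := by rw [div_eq_div_iff hNr hN'r]; linarith
  rw [← hρ] at h2
  set a := ‖∑ t ∈ Finset.range M, cexp (I * (q / N : ℝ) * t)‖ / (M : ℝ) with ha
  set c := ‖∑ t ∈ Finset.range M', cexp (I * (q / N' : ℝ) * t)‖ / (M' : ℝ) with hc
  set L := sincAt ((M : ℝ) / N) q with hL
  calc abs (a - c) ≤ abs (a - L) + abs (L - c) := abs_sub_le a L c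
    _ ≤ π / 48 * q ^ 2 / N ^ 2 + π / 48 * q ^ 2 / N' ^ 2 := by
        refine add_le_add h1 ?_
        rw [abs_sub_comm]
        exact h2
    _ = _ := by ring

/-! ## §3  Row item (i), phases: the phase/modulus factorisation and the level-independence identities of B1 -/

/-- [folklore] **PHASE/MODULUS FACTORISATION** of the geometric sum at a real `x` with `sin(x/2) ≠ 0`:
`G(x, M) = e^{i(M−1)x/2} · (sin(Mx/2)/sin(x/2))` — a pure phase times the REAL Dirichlet-type kernel. -/
theorem geomExp_eq_phase_mul (x : ℝ) (M : ℕ) (hx : Real.sin (x / 2) ≠ 0) :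
    ∑ t ∈ Finset.range M, cexp (I * x * t)
      = cexp (I * (((M : ℝ) - 1) * x / 2 : ℝ)) * ((Real.sin (M * x / 2) / Real.sin (x / 2) : ℝ) : ℂ) := by
  have h1 := geomExp_mul_sub_one (x : ℂ) M
  have e1 := SymbolTaylor.cexp_I_mul_sub_one_eq x
  have e2 := SymbolTaylor.cexp_I_mul_sub_one_eq ((M : ℝ) * x)
  have hsx : ((Real.sin (x / 2) : ℝ) : ℂ) ≠ 0 := by exact_mod_cast hx
  have hne : cexp (I * x) - 1 ≠ 0 := by
    rw [e1]
    exact mul_ne_zero (Complex.exp_ne_zero _) (mul_ne_zero (mul_ne_zero two_ne_zero Complex.I_ne_zero) hsx)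
  apply mul_right_cancel₀ hne
  rw [h1, show I * (x : ℂ) * (M : ℂ) = I * (((M : ℝ) * x : ℝ) : ℂ) by push_cast; ring, e2, e1]
  have hexp : cexp (I * (((M : ℝ) * x) / 2 : ℝ)) = cexp (I * (((M : ℝ) - 1) * x / 2 : ℝ)) * cexp (I * (x / 2 : ℝ)) := by
    rw [← Complex.exp_add]
    congr 1
    push_cast
    ring
  have hsx' : Complex.sin ((x : ℂ) / 2) ≠ 0 := by
    have h := hsx
    push_cast at h
    exact h
  rw [hexp]
  push_cast
  field_simp

/-- [folklore] LEVEL-INDEPENDENCE OF THE READING PHASE (B1): with fine momentum `k = q/(M·Lc)` (box `N = M·Lc`) and block `M`, the phase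
exponent `k·M = q/Lc` does not depend on the level — the same identity at the next level reads `(q/(N·Lc))·N = q/Lc`. -/
theorem fine_mul_block_eq {q Lc M : ℝ} (hM : M ≠ 0) (hLc : Lc ≠ 0) : q / (M * Lc) * M = q / Lc := by
  field_simp

/-- [folklore] HALF-BOND PHASE BOOKKEEPING (B1): the phases `e^{i(M−1)x_κ/2}` of `s_κ`, `e^{−i(M−1)x_l/2}` of `s♭_l` and the
`e^{i(x_κ − x_l)/2}` of the transverse symbol `∂̂_κ∂̂♭_l/|∂̂|²` (`SymbolProjector.dhat_mul_dflat_div_lapSym_ofRealVec`) combine to the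
level-free `e^{iM(x_κ − x_l)/2}` (`M x = q/Lc`): the exponents satisfy `(M−1)x_κ/2 − (M−1)x_l/2 + (x_κ − x_l)/2 = M(x_κ − x_l)/2`. -/
theorem half_bond_phases_combine (M xκ xl : ℝ) :
    cexp (I * (((M - 1) * xκ / 2 : ℝ) : ℂ)) * cexp (-(I * (((M - 1) * xl / 2 : ℝ) : ℂ))) * cexp (I * (((xκ - xl) / 2 : ℝ) : ℂ))
      = cexp (I * ((M * (xκ - xl) / 2 : ℝ) : ℂ)) := by
  rw [← Complex.exp_add, ← Complex.exp_add]
  congr 1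
  push_cast
  ring

/-! ## §4  Row item (ii): phase-stripped two-scale rates of the scaled `T`-block coefficients (real `N > 0`) -/

/-- [folklore] TWO-LEVEL rate of the scaled lattice symbol `A_N(q) = Σ_κ (2N sin(q_κ/(2N)))²` (both levels are within `|q|⁴/(12N²)` of
`|q|²`, `SymbolTaylor.abs_sum_sq_mul_four_sin_sq_sub_momSq_le`): `|A_N(q) − A_{N′}(q)| ≤ (|q|⁴/12)·(1/N² + 1/N′²)`, all `q`. -/
theorem abs_lat_sub_lat_le {N N' : ℝ} (hN : N ≠ 0) (hN' : N' ≠ 0) (q : Fin D → ℝ) :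
    |∑ κ, N ^ 2 * (4 * Real.sin (q κ / (2 * N)) ^ 2) - ∑ κ, N' ^ 2 * (4 * Real.sin (q κ / (2 * N')) ^ 2)|
      ≤ momSq q ^ 2 / 12 * (1 / N ^ 2 + 1 / N' ^ 2) := by
  have h1 := SymbolTaylor.abs_sum_sq_mul_four_sin_sq_sub_momSq_le hN q
  have h2 := SymbolTaylor.abs_sum_sq_mul_four_sin_sq_sub_momSq_le hN' q
  set a := ∑ κ, N ^ 2 * (4 * Real.sin (q κ / (2 * N)) ^ 2) with ha
  set c := ∑ κ, N' ^ 2 * (4 * Real.sin (q κ / (2 * N')) ^ 2) with hc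
  have hN2 : 0 < N ^ 2 := by positivity
  have hN2' : 0 < N' ^ 2 := by positivity
  calc |a - c| ≤ |a - momSq q| + |momSq q - c| := abs_sub_le a (momSq q) c
    _ ≤ momSq q ^ 2 / (12 * N ^ 2) + momSq q ^ 2 / (12 * N' ^ 2) := by
        refine add_le_add (h1.1.trans h1.2) ?_
        rw [abs_sub_comm]
        exact h2.1.trans h2.2
    _ = _ := by field_simp

/-- [folklore] INVERSE SYMBOL RATE on the zone: `|A_N(q)⁻¹ − |q|⁻²| ≤ (π²/48)/N²` for `|q_κ| ≤ πN`, `q ≠ 0` — King 1986 (4.10)-type bound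
`King1986.latticeSymbol_inv_sub_ref_le` BY NAME through the dictionary `SymbolTaylor.sum_sq_mul_four_sin_sq_eq_latticeSymbol` (`η = N⁻¹`, mass `0`). -/
theorem abs_inv_lat_sub_inv_momSq_le {N : ℝ} (hN : 0 < N) {q : Fin D → ℝ} (hq : ∀ κ, |q κ| ≤ π * N) (hq0 : 0 < momSq q) :
    |(∑ κ, N ^ 2 * (4 * Real.sin (q κ / (2 * N)) ^ 2))⁻¹ - (momSq q)⁻¹| ≤ π ^ 2 / 48 / N ^ 2 := by
  rw [SymbolTaylor.sum_sq_mul_four_sin_sq_eq_latticeSymbol hN.ne' q]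
  have hη : (N⁻¹ : ℝ) ≠ 0 := inv_ne_zero hN.ne'
  have hp : ∀ μ, |N⁻¹ * q μ| ≤ π := fun μ => by
    rw [abs_mul, abs_inv, abs_of_pos hN, inv_mul_le_iff₀ hN]
    linarith [hq μ]
  have h := latticeSymbol_inv_sub_ref_le hη (le_refl (0 : ℝ)) hp hq0
  rw [add_zero] at h
  calc _ ≤ π ^ 2 / 48 * N⁻¹ ^ 2 := h
    _ = π ^ 2 / 48 / N ^ 2 := by rw [inv_pow]; ring

/-- [folklore] TWO-LEVEL inverse symbol rate: `|A_N(q)⁻¹ − A_{N′}(q)⁻¹| ≤ (π²/48)·(1/N² + 1/N′²)` on the common zone. -/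
theorem abs_inv_lat_sub_inv_lat_le {N N' : ℝ} (hN : 0 < N) (hN' : 0 < N') {q : Fin D → ℝ}
    (hq : ∀ κ, |q κ| ≤ π * N) (hq' : ∀ κ, |q κ| ≤ π * N') (hq0 : 0 < momSq q) :
    |(∑ κ, N ^ 2 * (4 * Real.sin (q κ / (2 * N)) ^ 2))⁻¹ - (∑ κ, N' ^ 2 * (4 * Real.sin (q κ / (2 * N')) ^ 2))⁻¹|
      ≤ π ^ 2 / 48 * (1 / N ^ 2 + 1 / N' ^ 2) := by
  have h1 := abs_inv_lat_sub_inv_momSq_le hN hq hq0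
  have h2 := abs_inv_lat_sub_inv_momSq_le hN' hq' hq0
  set a := (∑ κ, N ^ 2 * (4 * Real.sin (q κ / (2 * N)) ^ 2))⁻¹ with ha
  set c := (∑ κ, N' ^ 2 * (4 * Real.sin (q κ / (2 * N')) ^ 2))⁻¹ with hc
  calc |a - c| ≤ |a - (momSq q)⁻¹| + |(momSq q)⁻¹ - c| := abs_sub_le a _ c
    _ ≤ π ^ 2 / 48 / N ^ 2 + π ^ 2 / 48 / N' ^ 2 := add_le_add h1 (by rw [abs_sub_comm]; exact h2)
    _ = _ := by ring

/-- [folklore] TWO-LEVEL rate of the (phase-stripped) sine vector `s^N_κ = 2N sin(q_κ/(2N))` (both within `|q_κ|³/(24N²)` of `q_κ`,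
`SymbolTaylor.abs_two_mul_sin_sub_le`): `|s^N_κ − s^{N′}_κ| ≤ (|q_κ|³/24)·(1/N² + 1/N′²)`. -/
theorem abs_sinVec_sub_sinVec_le {N N' : ℝ} (hN : 0 < N) (hN' : 0 < N') (q : ℝ) :
    |2 * N * Real.sin (q / (2 * N)) - 2 * N' * Real.sin (q / (2 * N'))| ≤ |q| ^ 3 / 24 * (1 / N ^ 2 + 1 / N' ^ 2) := by
  have h1 := SymbolTaylor.abs_two_mul_sin_sub_le hN q
  have h2 := SymbolTaylor.abs_two_mul_sin_sub_le hN' q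
  set a := 2 * N * Real.sin (q / (2 * N)) with ha
  set c := 2 * N' * Real.sin (q / (2 * N')) with hc
  have hN2 : 0 < N ^ 2 := by positivity
  have hN2' : 0 < N' ^ 2 := by positivity
  calc |a - c| ≤ |a - q| + |q - c| := abs_sub_le a q c
    _ ≤ |q| ^ 3 / (24 * N ^ 2) + |q| ^ 3 / (24 * N' ^ 2) := add_le_add h1 (by rw [abs_sub_comm]; exact h2)
    _ = _ := by field_simp

/-- [folklore] TWO-LEVEL rate of the (phase-stripped) TRANSVERSE PROJECTOR entries built from the sine vectors
(`SymbolProjector.abs_proj_sin_sub_proj_le` at both levels): `≤ (|q|²/6)·(1/N² + 1/N′²)`, `q ≠ 0`. -/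
theorem abs_projSin_sub_projSin_le {N N' : ℝ} (hN : 0 < N) (hN' : 0 < N') {q : Fin D → ℝ} (hq0 : 0 < momSq q) (κ l : Fin D) :
    |(2 * N * Real.sin (q κ / (2 * N))) * (2 * N * Real.sin (q l / (2 * N))) / momSq (fun i => 2 * N * Real.sin (q i / (2 * N)))
        - (2 * N' * Real.sin (q κ / (2 * N'))) * (2 * N' * Real.sin (q l / (2 * N')))
            / momSq (fun i => 2 * N' * Real.sin (q i / (2 * N')))|
      ≤ momSq q / 6 * (1 / N ^ 2 + 1 / N' ^ 2) := by
  have h1 := SymbolProjector.abs_proj_sin_sub_proj_le hN hq0 κ l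
  have h2 := SymbolProjector.abs_proj_sin_sub_proj_le hN' hq0 κ l
  set a := (2 * N * Real.sin (q κ / (2 * N))) * (2 * N * Real.sin (q l / (2 * N)))
      / momSq (fun i => 2 * N * Real.sin (q i / (2 * N))) with ha
  set c := (2 * N' * Real.sin (q κ / (2 * N'))) * (2 * N' * Real.sin (q l / (2 * N')))
      / momSq (fun i => 2 * N' * Real.sin (q i / (2 * N'))) with hc
  set b := q κ * q l / momSq q with hb
  have hN2 : 0 < N ^ 2 := by positivity
  have hN2' : 0 < N' ^ 2 := by positivity
  calc |a - c| ≤ |a - b| + |b - c| := abs_sub_le a b c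
    _ ≤ momSq q / (6 * N ^ 2) + momSq q / (6 * N' ^ 2) := add_le_add h1 (by rw [abs_sub_comm]; exact h2)
    _ = _ := by field_simp

/-- [folklore] **MIXED COEFFICIENT RATE** (the longitudinal / multiplier entries of `FibreBlockSolve.Asol/musol` in scaled form): on the zone
`|q_κ| ≤ πN`, `q ≠ 0`, the coefficient `s^N_κ / A_N(q)` is within `(π²/32)·|q|/N²` of its limit `q_κ/|q|²`
(`|s − q_κ| ≤ |q_κ|³/(24N²)`, `A_N ≥ (4/π²)|q|²`, `|A_N⁻¹ − |q|⁻²| ≤ (π²/48)/N²`; relative size `O(|q|²/N²)` against `|q_κ|/|q|² ≤ 1/|q|`). -/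
theorem abs_sin_div_lat_sub_le {N : ℝ} (hN : 0 < N) {q : Fin D → ℝ} (hq : ∀ κ, |q κ| ≤ π * N) (hq0 : 0 < momSq q) (κ : Fin D) :
    |2 * N * Real.sin (q κ / (2 * N)) / (∑ l, N ^ 2 * (4 * Real.sin (q l / (2 * N)) ^ 2)) - q κ / momSq q|
      ≤ π ^ 2 / 32 * Real.sqrt (momSq q) / N ^ 2 := by
  set A := ∑ l, N ^ 2 * (4 * Real.sin (q l / (2 * N)) ^ 2) with hA
  set s := 2 * N * Real.sin (q κ / (2 * N)) with hs
  set Q := momSq q with hQ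
  have hπ := Real.pi_pos
  have hAlow : 4 / π ^ 2 * Q ≤ A := (SymbolTaylor.two_sided_sq_mul_lapSym hN hq).1
  have hApos : 0 < A := lt_of_lt_of_le (by positivity) hAlow
  have hs_q : |s - q κ| ≤ |q κ| ^ 3 / (24 * N ^ 2) := SymbolTaylor.abs_two_mul_sin_sub_le hN (q κ)
  have hinv : |A⁻¹ - Q⁻¹| ≤ π ^ 2 / 48 / N ^ 2 := abs_inv_lat_sub_inv_momSq_le hN hq hq0
  -- |q_κ| ≤ √Q and |q_κ|² ≤ Q
  have hqκ : |q κ| ≤ Real.sqrt Q := SymbolProjector.abs_apply_le_sqrt_momSq q κ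
  have hqκ2 : q κ ^ 2 ≤ Q := by
    rw [hQ]; unfold momSq
    exact Finset.single_le_sum (fun l _ => sq_nonneg (q l)) (Finset.mem_univ κ)
  have hsqrtQ : 0 < Real.sqrt Q := Real.sqrt_pos.2 hq0
  have hQeq : Q = Real.sqrt Q ^ 2 := (Real.sq_sqrt hq0.le).symm
  -- split: s/A − q/Q = (s − q)/A + q (1/A − 1/Q)
  have e : s / A - q κ / Q = (s - q κ) * A⁻¹ + q κ * (A⁻¹ - Q⁻¹) := by
    field_simp
    ring
  rw [e]
  have hAinv : A⁻¹ ≤ π ^ 2 / 4 / Q := by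
    have h := inv_anti₀ (by positivity : 0 < 4 / π ^ 2 * Q) hAlow
    refine h.trans (le_of_eq ?_)
    field_simp
  calc |(s - q κ) * A⁻¹ + q κ * (A⁻¹ - Q⁻¹)|
      ≤ |s - q κ| * A⁻¹ + |q κ| * |A⁻¹ - Q⁻¹| := by
        refine (abs_add_le _ _).trans (le_of_eq ?_)
        rw [abs_mul, abs_mul, abs_of_pos (inv_pos.2 hApos)]
    _ ≤ (|q κ| ^ 3 / (24 * N ^ 2)) * (π ^ 2 / 4 / Q) + Real.sqrt Q * (π ^ 2 / 48 / N ^ 2) := by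
        gcongr
    _ ≤ (Real.sqrt Q * Q / (24 * N ^ 2)) * (π ^ 2 / 4 / Q) + Real.sqrt Q * (π ^ 2 / 48 / N ^ 2) := by
        gcongr
        -- |q_κ|³ ≤ √Q · Q
        calc |q κ| ^ 3 = |q κ| * q κ ^ 2 := by rw [← sq_abs]; ring
          _ ≤ Real.sqrt Q * Q := mul_le_mul hqκ hqκ2 (sq_nonneg _) hsqrtQ.le
    _ = π ^ 2 / 32 * Real.sqrt Q / N ^ 2 := by
        field_simp
        ring

end Summit.QuantumFields.BalabanUV.Beta.GAN24.ReadingWeightRates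

end
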